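import Summits.Ventures.HodgeRepro2.WeilVector
import Summits.Ventures.HodgeRepro2.A2HardLefschetzOps

/-!
# Plane-sorted monomials of the twelve-plane model (A2 annex, operator identity — part 1)

The exterior algebra `A ι = ⋀(V ι)` of the model (p5's `WeilPlanes`) has the generators
`a_p = gen (p, false)`, `b_p = gen (p, true)` for each plane `p : ι`.  A **plane-sorted monomial**
is a product `∏_{p ∈ L} m_p` over a list of planes `L`, where each factor `m_p` is one of
`1, a_p, b_p, E_p = a_p ∧ b_p`, selected by a pair of Booleans `m p : Bool × Bool`.

Every monomial of the standard basis is, up to a sign, a plane-sorted monomial over the full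
list of planes (`exists_sign_planeProd`), and the plane contraction `Λ_p = ι_{b_p^*} ∘ ι_{a_p^*}`
of `A2HardLefschetzOps.lamAt` acts on them by *removing the factor `E_p`* (`lamAt_planeProd`),
with no sign.  These are the bookkeeping facts behind the operator identity
`z ⋆ θ^k = (k!/(n−k)!)·(∏ c_p)·vol • Λ^{n−k} z` of the later files.
-/

namespace Summit.Ventures.HodgeRepro2.A2PlaneMonomials

open WeilPlanes WeilIntegral A2HardLefschetzOps

section lists

variable {ι : Type*}

/-- The generator sub-list of one plane selected by a pair of Booleans: `[]`, `[a_p]`, `[b_p]`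
or `[a_p, b_p]`. -/
def pl (p : ι) (m : Bool × Bool) : List (Gen ι) :=
  (if m.1 then [(p, false)] else []) ++ (if m.2 then [(p, true)] else [])

/-- Membership in the sub-list of a plane. -/
lemma mem_pl {p : ι} {m : Bool × Bool} {j : Gen ι} :
    j ∈ pl p m ↔ (j = (p, false) ∧ m.1 = true) ∨ (j = (p, true) ∧ m.2 = true) := by
  unfold pl
  rcases m with ⟨s, t⟩
  cases s <;> cases t <;> simp

/-- Every generator of the sub-list `pl p m` lies in the plane `p`. -/
lemma fst_eq_of_mem_pl {p : ι} {m : Bool × Bool} {j : Gen ι} (hj : j ∈ pl p m) : j.1 = p := by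
  rcases mem_pl.1 hj with ⟨rfl, _⟩ | ⟨rfl, _⟩ <;> rfl

/-- The sub-list of a plane has no repetition. -/
lemma nodup_pl (p : ι) (m : Bool × Bool) : (pl p m).Nodup := by
  unfold pl
  rcases m with ⟨s, t⟩
  cases s <;> cases t <;> simp

/-- The generator list of a plane-sorted monomial. -/
def flat (L : List ι) (m : ι → Bool × Bool) : List (Gen ι) :=
  L.flatMap fun p => pl p (m p)

/-- The generator list over no planes is empty. -/
@[simp] lemma flat_nil (m : ι → Bool × Bool) : flat [] m = [] := by
  simp [flat]

/-- The generator list over `q :: L` is the sub-list of `q` followed by the list over `L`. -/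
@[simp] lemma flat_cons (q : ι) (L : List ι) (m : ι → Bool × Bool) :
    flat (q :: L) m = pl q (m q) ++ flat L m := by
  simp [flat]

/-- Membership in the generator list of a plane-sorted monomial. -/
lemma mem_flat {L : List ι} {m : ι → Bool × Bool} {j : Gen ι} :
    j ∈ flat L m ↔ j.1 ∈ L ∧ j ∈ pl j.1 (m j.1) := by
  unfold flat
  rw [List.mem_flatMap]
  constructor
  · rintro ⟨p, hp, hj⟩
    have := fst_eq_of_mem_pl hj
    subst this
    exact ⟨hp, hj⟩
  · rintro ⟨hp, hj⟩
    exact ⟨j.1, hp, hj⟩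

/-- The generator list of a plane-sorted monomial over a list of distinct planes has no
repetition. -/
lemma nodup_flat {L : List ι} (hL : L.Nodup) (m : ι → Bool × Bool) : (flat L m).Nodup := by
  unfold flat
  rw [List.nodup_flatMap]
  refine ⟨fun p _ => nodup_pl p (m p), ?_⟩
  refine hL.imp ?_
  intro p q hpq
  rw [Function.onFun, List.disjoint_left]
  intro j hjp hjq
  exact hpq ((fst_eq_of_mem_pl hjp).symm.trans (fst_eq_of_mem_pl hjq))

/-- The indicator of a generator list: which generators of each plane occur. -/
def ind [DecidableEq ι] (l : List (Gen ι)) : ι → Bool × Bool :=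
  fun p => (decide ((p, false) ∈ l), decide ((p, true) ∈ l))

/-- The generator list of the plane-sorted monomial indexed by `ind l` has the members of `l`. -/
lemma mem_flat_ind [DecidableEq ι] [Fintype ι] (l : List (Gen ι)) (j : Gen ι) :
    j ∈ flat Finset.univ.toList (ind l) ↔ j ∈ l := by
  rw [mem_flat, mem_pl]
  rcases j with ⟨p, b⟩
  cases b <;> simp [ind]

end lists

variable {ι : Type*} [DecidableEq ι]

/-- The plane factor `1`, `a_p`, `b_p` or `E_p` selected by `m`. -/
noncomputable def pf (p : ι) (m : Bool × Bool) : A ι := mono (pl p m)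

/-- `pf p (false, false) = 1`. -/
@[simp] lemma pf_ff (p : ι) : pf p (false, false) = 1 := by
  simp [pf, pl, mono]

/-- `pf p (true, false) = a_p`. -/
@[simp] lemma pf_tf (p : ι) : pf p (true, false) = gen (p, false) := by
  simp [pf, pl, mono]

/-- `pf p (false, true) = b_p`. -/
@[simp] lemma pf_ft (p : ι) : pf p (false, true) = gen (p, true) := by
  simp [pf, pl, mono]

/-- `pf p (true, true) = E_p`. -/
@[simp] lemma pf_tt (p : ι) : pf p (true, true) = E p := by
  simp [pf, pl, mono, E]

/-- The plane-sorted monomial `∏_{p ∈ L} pf p (m p)`. -/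
noncomputable def planeProd (L : List ι) (m : ι → Bool × Bool) : A ι :=
  (L.map fun p => pf p (m p)).prod

/-- The plane-sorted monomial over no planes is `1`. -/
@[simp] lemma planeProd_nil (m : ι → Bool × Bool) : planeProd [] m = 1 := by
  simp [planeProd]

/-- The plane-sorted monomial over `q :: L` is the factor of `q` times the monomial over `L`. -/
@[simp] lemma planeProd_cons (q : ι) (L : List ι) (m : ι → Bool × Bool) :
    planeProd (q :: L) m = pf q (m q) * planeProd L m := by
  simp [planeProd]

/-- A plane-sorted monomial is the monomial of its generator list. -/
lemma planeProd_eq_mono (L : List ι) (m : ι → Bool × Bool) :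
    planeProd L m = mono (flat L m) := by
  induction L with
  | nil => simp [mono]
  | cons q L ih => rw [planeProd_cons, flat_cons, mono_append, ih]; rfl

/-- **Every standard monomial is a plane-sorted monomial up to sign**: for a list `l` of distinct
generators, `mono l = ± planeProd univ (ind l)`. -/
theorem exists_sign_planeProd [Fintype ι] {l : List (Gen ι)} (hl : l.Nodup) :
    ∃ ε : ℂ, (ε = 1 ∨ ε = -1) ∧
      mono l = ε • planeProd Finset.univ.toList (ind l) := by
  rw [planeProd_eq_mono]
  apply WeilVector.mono_perm
  apply List.perm_of_nodup_nodup_toFinset_eq hl (nodup_flat (Finset.nodup_toList _) _)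
  ext j
  simp only [List.mem_toFinset]
  exact (mem_flat_ind l j).symm

/-! ## The plane contractions on plane-sorted monomials -/

omit [DecidableEq ι] in
/-- A contraction kills the unit. -/
lemma contr_one (d : Module.Dual ℂ (V ι)) : contr d (1 : A ι) = 0 :=
  CliffordAlgebra.contractLeft_one _ d

/-- A contraction by the dual of a generator `k` passes through a monomial avoiding `k`,
with the sign `(-1)^{length}`. -/
lemma contr_dual_mono_mul_of_forall_ne (k : Gen ι) {l : List (Gen ι)} (hl : ∀ j ∈ l, j ≠ k)
    (x : A ι) :
    contr (dual k) (mono l * x) = ((-1 : ℂ) ^ l.length) • (mono l * contr (dual k) x) := by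
  induction l with
  | nil => simp [mono]
  | cons j l ih =>
    have hj : j ≠ k := hl j (List.mem_cons_self ..)
    have hl' : ∀ j' ∈ l, j' ≠ k := fun j' hj' => hl j' (List.mem_cons_of_mem _ hj')
    have hm : mono (j :: l) = gen j * mono l := by simp [mono]
    rw [hm, mul_assoc, contr_dual_gen_mul, if_neg (Ne.symm hj), zero_sub, ih hl', mul_smul_comm,
      List.length_cons, pow_succ, mul_neg_one, neg_smul, mul_assoc]

/-- `Λ_p` passes through a monomial whose generators lie outside the plane `p`. -/
lemma lamAt_mono_mul_of_forall_ne (p : ι) {l : List (Gen ι)} (hl : ∀ j ∈ l, j.1 ≠ p)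
    (x : A ι) : lamAt p (mono l * x) = mono l * lamAt p x := by
  have h1 : ∀ j ∈ l, j ≠ (p, false) := fun j hj h => hl j hj (by rw [h])
  have h2 : ∀ j ∈ l, j ≠ (p, true) := fun j hj h => hl j hj (by rw [h])
  simp only [lamAt, LinearMap.comp_apply]
  rw [contr_dual_mono_mul_of_forall_ne _ h1, map_smul, contr_dual_mono_mul_of_forall_ne _ h2,
    smul_smul, ← mul_pow, neg_one_mul, neg_neg, one_pow, one_smul]

/-- A contraction by a dual generator of the plane `p` kills a plane-sorted monomial over a list
of planes not containing `p`. -/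
lemma contr_dual_planeProd_eq_zero {L : List ι} {p : ι} (hp : p ∉ L) (b : Bool)
    (m : ι → Bool × Bool) : contr (dual (p, b)) (planeProd L m) = 0 := by
  induction L with
  | nil => rw [planeProd_nil, contr_one]
  | cons q L ih =>
    have hq : q ≠ p := fun h => hp (h ▸ List.mem_cons_self ..)
    have hL : p ∉ L := fun h => hp (List.mem_cons_of_mem _ h)
    rw [planeProd_cons, pf, contr_dual_mono_mul_of_forall_ne, ih hL, mul_zero, smul_zero]
    intro j hj h
    exact hq ((fst_eq_of_mem_pl hj).symm.trans (congrArg Prod.fst h))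

/-- `Λ_p` on the product of a plane-`p` factor with an element killed by the two contractions
of the plane: only the factor `E_p` survives, and it is simply removed. -/
lemma lamAt_pf_mul (p : ι) (m : Bool × Bool) {x : A ι}
    (hx : ∀ b, contr (dual (p, b)) x = 0) :
    lamAt p (pf p m * x) = if m = (true, true) then x else 0 := by
  rcases m with ⟨s, t⟩
  cases s <;> cases t
  · simp [lamAt, hx]
  · simp [lamAt, contr_dual_gen_mul, hx]
  · simp [lamAt, contr_dual_gen_mul, hx]
  · simp [lamAt, E, mul_assoc, contr_dual_gen_mul, hx]

/-- Updating `m` at a plane outside `L` does not change the plane-sorted monomial. -/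
lemma planeProd_update_of_notMem {L : List ι} {p : ι} (hp : p ∉ L) (m : ι → Bool × Bool)
    (v : Bool × Bool) : planeProd L (Function.update m p v) = planeProd L m := by
  induction L with
  | nil => simp
  | cons q L ih =>
    have hq : q ≠ p := fun h => hp (h ▸ List.mem_cons_self ..)
    have hL : p ∉ L := fun h => hp (List.mem_cons_of_mem _ h)
    rw [planeProd_cons, planeProd_cons, ih hL, Function.update_of_ne hq]

/-- **`Λ_p` removes the factor `E_p`** from a plane-sorted monomial over distinct planes, and kills
it if the plane `p` is absent or carries a factor other than `E_p`. -/
theorem lamAt_planeProd {L : List ι} (hL : L.Nodup) (p : ι) (m : ι → Bool × Bool) :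
    lamAt p (planeProd L m) =
      if p ∈ L ∧ m p = (true, true) then planeProd L (Function.update m p (false, false))
      else 0 := by
  induction L with
  | nil => simp [lamAt, contr_one]
  | cons q L ih =>
    have hqL : q ∉ L := (List.nodup_cons.1 hL).1
    have hL' : L.Nodup := (List.nodup_cons.1 hL).2
    by_cases hq : q = p
    · subst hq
      rw [planeProd_cons, lamAt_pf_mul q (m q) (fun b => contr_dual_planeProd_eq_zero hqL b m)]
      by_cases hm : m q = (true, true)
      · rw [if_pos hm, if_pos ⟨List.mem_cons_self .., hm⟩, planeProd_cons,
          planeProd_update_of_notMem hqL, Function.update_self, pf_ff, one_mul]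
      · rw [if_neg hm, if_neg (fun h => hm h.2)]
    · rw [planeProd_cons, pf, lamAt_mono_mul_of_forall_ne p
        (fun j hj h => hq ((fst_eq_of_mem_pl hj).symm.trans h)), ih hL']
      have hmem : p ∈ q :: L ↔ p ∈ L := by
        rw [List.mem_cons]
        exact ⟨fun h => h.resolve_left (Ne.symm hq), Or.inr⟩
      by_cases hp : p ∈ L ∧ m p = (true, true)
      · rw [if_pos hp, if_pos ⟨hmem.2 hp.1, hp.2⟩, planeProd_cons, Function.update_of_ne hq, pf]
      · rw [if_neg hp, if_neg (fun h => hp ⟨hmem.1 h.1, h.2⟩), mul_zero]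

/-- A plane-sorted monomial carrying the factor `E_p` is `E_p` times the monomial with that factor
removed (`E_p` is central). -/
theorem planeProd_eq_E_mul {L : List ι} (hL : L.Nodup) {p : ι} (hp : p ∈ L)
    {m : ι → Bool × Bool} (hm : m p = (true, true)) :
    planeProd L m = E p * planeProd L (Function.update m p (false, false)) := by
  induction L with
  | nil => simp at hp
  | cons q L ih =>
    have hqL : q ∉ L := (List.nodup_cons.1 hL).1
    have hL' : L.Nodup := (List.nodup_cons.1 hL).2
    by_cases hq : q = p
    · subst hq
      rw [planeProd_cons, planeProd_cons, hm, pf_tt, planeProd_update_of_notMem hqL,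
        Function.update_self, pf_ff, one_mul]
    · have hpL : p ∈ L := by
        rcases List.mem_cons.1 hp with h | h
        · exact absurd h.symm hq
        · exact h
      rw [planeProd_cons, planeProd_cons, Function.update_of_ne hq, ih hL' hpL,
        ← mul_assoc, ← (commute_E p (pf q (m q))).eq, mul_assoc]

/-- Removing a finite set of planes from the data `m` (their factors become `1`). -/
def eraseS (m : ι → Bool × Bool) (S : Finset ι) : ι → Bool × Bool :=
  fun p => if p ∈ S then (false, false) else m p

/-- Removing no plane changes nothing. -/
@[simp] lemma eraseS_empty (m : ι → Bool × Bool) : eraseS m ∅ = m := by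
  funext p; simp [eraseS]

/-- Removing `insert p S` is removing `S` and then updating at `p`. -/
lemma eraseS_insert (m : ι → Bool × Bool) (p : ι) (S : Finset ι) :
    eraseS m (insert p S) = Function.update (eraseS m S) p (false, false) := by
  funext q
  by_cases hq : q = p
  · subst hq; simp [eraseS]
  · simp [eraseS, hq]

/-- Outside the removed set the data are unchanged. -/
lemma eraseS_apply_of_notMem (m : ι → Bool × Bool) {S : Finset ι} {p : ι} (hp : p ∉ S) :
    eraseS m S p = m p := by
  simp [eraseS, hp]

/-- On the removed set the factor is `1`. -/
lemma eraseS_apply_of_mem (m : ι → Bool × Bool) {S : Finset ι} {p : ι} (hp : p ∈ S) :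
    eraseS m S p = (false, false) := by
  simp [eraseS, hp]

end Summit.Ventures.HodgeRepro2.A2PlaneMonomials
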